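import Literature.NumberTheory.EllipticCurves.KubertTateFiveGaussianTwistRankBound
import HarnessLib

/-!
# CLASS-WIDE: `t₅(E_{m,n}^{(-4)}) = 0` as soon as the twist's rank ATTAINS the descent bound `ω₁(mn)` — the door at `5`
# on the quadratic twists by `-1` of the Gaussian-tame Kubert–Tate curves, decided by the rank

PROOF-ONLY file (theorems only, no definition, no named fact, no `sorry`), topic `NumberTheory/EllipticCurves`; sequel of
`KubertTateFiveGaussianTwistRankBound` (`rank E_{m,n}^{(-4)}(ℚ) ≤ ω₁(mn)`) and `KubertTateFiveMuDescentGaussianBox`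
(`t₅(E_{m,n}/ℚ(i)) = 0` when the `ℚ(i)`-points fill the box).  Setting: `E = E_{m,n}` over `ℚ`, Gaussian tame (`5 ∤ Δ`; bad
`ℓ ≢ 1 (5)`, `ℓ ≡ 4 (5) ⇒ ℓ ≡ 1 (4)`), `ℚ`-box full (`ω(mn) ≤ rank E(ℚ) + 1`), a rational point `(x, y)` with `x ∉ {0, mn}` and a
good prime `q ≤ 11`, `ω₁(mn) = #{ℓ ∣ mn : ℓ ≡ 1 (4)}`.

* `box_full_of_card_le_rank_succ` — `5 ^ #S ≤ #(E(ℚ(i))/5E(ℚ(i)))` whenever `#S ≤ rank E(ℚ(i)) + 1`.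
* **`twist_door_of_le_rank`** — if `ω₁(mn) ≤ rank E_{m,n}^{(-4)}(ℚ)` then **`t₅(E_{m,n}^{(-4)}/ℚ) = 0`, `t₅(E_{m,n}/ℚ) = 0`,
  `t₅(E_{m,n} ⊗ ℚ(i)) = 0` and `rank E_{m,n}^{(-4)}(ℚ) = ω₁(mn)`** — the `5`-primary Tate–Shafarevich group of the twist (a curve
  WITHOUT rational `5`-torsion) is finite with corank `0` BY DESCENT ALONE as soon as its Mordell–Weil rank reaches the number of
  primes `≡ 1 (mod 4)` of `mn`.  (`ω₁ = 0`: the tree's `KubertTateGaussianTwist.shaCorank_five_twist_eq_zero_and`, rank `0`;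
  `ω₁ = 1, 2`: attained at `(13, 3)`, `(146, 13)` by the matrix instances.)

This is the `ℚ(i)`-analogue of the tree's class-wide `ℚ`-criterion `KubertTateMuDescent.shaCorank_five_eq_zero_of_le_mordellWeilRank_succ`
(`t₅(E_{m,n}) = 0` whenever `rank E_{m,n}(ℚ) + 1 ≥ ω(mn)`).  Transfer statement T (stmt-22356) instrument; BSD is not proved.

## References

* [SilvermanAEC2009] J. H. Silverman, *AEC*, 2nd ed., Thm. X.4.2, Prop. X.4.9, Exercise 10.16.
* [Fisher2001FiveSevenDescent] T. Fisher, JEMS 3 (2001), §§1–2.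
* [Dokchitser2013ParityNotes] T. Dokchitser, Notes on the parity conjecture (2013), §4 (Selmer coranks under quadratic base change).
-/

noncomputable section

open scoped Classical NNReal NumberField AddSubgroup
open WeierstrassCurve WeierstrassCurve.Isogeny Field IsDedekindDomain Ideal
open Literature.NumberTheory.EllipticCurves Literature.NumberTheory.EllipticCurves.KubertTateVelu
  Literature.NumberTheory.EllipticCurves.KubertTateMuDescentNF Literature.NumberTheory.NumberFields

namespace Literature.NumberTheory.EllipticCurves

namespace KubertTateGaussianTwist

variable {K : Type} [Field K] [NumberField K] [IsCyclotomicExtension {4} ℚ K]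
variable (m n : ℤ) [hEQ : (kubertTateFive (m : ℚ) (n : ℚ)).IsElliptic]

/-- Transport of `t_p` along an equality of curves. [folklore] -/
private theorem shaCorank_congr' {F : Type} [Field F] [NumberField F] {V V' : WeierstrassCurve F}
    [V.IsElliptic] [V'.IsElliptic] (e : V = V') (p : ℕ) [Fact p.Prime] : V.shaCorank p = V'.shaCorank p := by
  subst e; rfl

/-- `[ℚ(ζ₄) : ℚ] = 2`. [folklore] -/
private theorem finrank_rat_four' : Module.finrank ℚ K = 2 := by
  rw [IsCyclotomicExtension.finrank (n := 4) K (Polynomial.cyclotomic.irreducible_rat (by norm_num)),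
    show Nat.totient 4 = 2 by decide]

/-! ## §1 The box is full as soon as `#S ≤ rank E(ℚ(i)) + 1` -/

omit [IsCyclotomicExtension {4} ℚ K] in
/-- **`5 ^ #S ≤ #(E(ℚ(i))/5E(ℚ(i)))` whenever `#S ≤ rank E_{m,n}(ℚ(i)) + 1`** (`#(E(K)/5E(K)) = 5^rank · #E(K)[5]` and
`T = (0,0) ∈ E(K)[5]` has order `5`). [cite: SilvermanAEC2009, Thm. X.4.2] -/
theorem box_full_of_card_le_rank_succ (S : Finset (HeightOneSpectrum (𝓞 K)))
    (hS : haveI := isElliptic_base (K := K) m n; S.card ≤ (kubertTateFive (m : K) (n : K)).mordellWeilRank + 1) :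
    haveI := isElliptic_base (K := K) m n
    5 ^ S.card ≤ Nat.card ((kubertTateFive (m : K) (n : K)).toAffine.Point ⧸ (nsmulAddMonoidHom (5 : ℕ) :
      (kubertTateFive (m : K) (n : K)).toAffine.Point →+ (kubertTateFive (m : K) (n : K)).toAffine.Point).range) := by
  haveI := isElliptic_base (K := K) m n
  set E := kubertTateFive (m : K) (n : K) with hEdef
  haveI : Module.Finite ℤ E.toAffine.Point := by convert module_finite_point_holds E
  rw [natCard_quotient_nsmulRange_eq E.toAffine.Point 5]
  obtain ⟨hm0, hn0, -⟩ := ne_zero_of_isElliptic (m : K) (n : K)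
  obtain ⟨T, hT⟩ := exists_addOrderOf_eq_five_kubertTateFive hm0 hn0
  have h5T : 5 ≤ Nat.card (AddSubgroup.torsionBy E.toAffine.Point ((5 : ℕ) : ℤ)) := by
    haveI : Finite (AddSubgroup.torsionBy E.toAffine.Point ((5 : ℕ) : ℤ)) :=
      Literature.NumberTheory.EllipticCurves.finite_torsionBy_of_injective
        (toGeomPoints E) (toGeomPoints_injective _) _
        (WeierstrassCurve.finite_torsionBy_of_isAlgClosed (V := E.baseChange (AlgebraicClosure K)) (by norm_num))
    have hsub : AddSubgroup.zmultiples T ≤ AddSubgroup.torsionBy _ ((5 : ℕ) : ℤ) := by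
      rw [AddSubgroup.zmultiples_le, mem_torsionBy_iff, natCast_zsmul, ← hT, addOrderOf_nsmul_eq_zero]
    have := AddSubgroup.card_le_of_le hsub
    rwa [Nat.card_zmultiples, hT] at this
  have hr : Module.finrank ℤ E.toAffine.Point = E.mordellWeilRank := by
    unfold WeierstrassCurve.mordellWeilRank; congr!
  have hle : S.card ≤ Module.finrank ℤ E.toAffine.Point + 1 := by rw [hr]; exact hS
  calc 5 ^ S.card ≤ 5 ^ (Module.finrank ℤ E.toAffine.Point + 1) := Nat.pow_le_pow_right (by norm_num) hle
    _ = 5 ^ Module.finrank ℤ E.toAffine.Point * 5 := by rw [pow_succ]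
    _ ≤ 5 ^ Module.finrank ℤ E.toAffine.Point * Nat.card (AddSubgroup.torsionBy E.toAffine.Point ((5 : ℕ) : ℤ)) :=
        Nat.mul_le_mul_left _ h5T

/-! ## §2 The door at `5` on the twist, decided by the rank -/

section Main

variable (h5 : ¬ (5 : ℤ) ∣ (kubertTateFive m n).Δ)
  (hbad : ∀ ℓ : ℕ, ℓ.Prime → (ℓ : ℤ) ∣ (kubertTateFive m n).Δ → ℓ % 5 ≠ 1 ∧ (ℓ % 5 = 4 → ℓ % 4 = 1))
  {x y : ℚ} (hxy : (kubertTateFive (m : ℚ) (n : ℚ)).toAffine.Nonsingular x y) (hx0 : x ≠ 0) (hx : x ≠ m * n)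
  (q : ℕ) [Fact q.Prime] (hq5 : q ≠ 5) (hq11 : 2 * q + 1 < 25) (hqΔ : ¬ (q : ℤ) ∣ (kubertTateFive m n).Δ)
  (hr : (m * n).natAbs.primeFactors.card ≤ (kubertTateFive (m : ℚ) (n : ℚ)).mordellWeilRank + 1)
  [htw : ((kubertTateFive (m : ℚ) (n : ℚ)).quadraticTwist (-4)).IsElliptic]
  (hr' : ((m * n).natAbs.primeFactors.filter (fun ℓ ↦ ℓ % 4 = 1)).card ≤
    ((kubertTateFive (m : ℚ) (n : ℚ)).quadraticTwist (-4)).mordellWeilRank)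

include h5 hbad hxy hx0 hx hq5 hq11 hqΔ hr hr' in
/-- **THE DOOR AT `5` ON THE TWIST, DECIDED BY THE RANK (class-wide).** For a Gaussian-tame `E_{m,n}` with full `ℚ`-box, if
`rank E_{m,n}^{(-4)}(ℚ) ≥ ω₁(mn)` then `t₅(E_{m,n}^{(-4)}/ℚ) = 0`, `t₅(E_{m,n}/ℚ) = 0` and `rank E_{m,n}^{(-4)}(ℚ) = ω₁(mn)` —
`t₅(E_K) = t₅(E) + t₅(E^{(-4)})`, `rank E_K = rank E + rank E^{(-4)}` at `K = ℚ(i)` (tree `selmerCorank_baseChange_quadratic_holds`,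
`mordellWeilRank_baseChange_quadratic_holds`, Greenberg's `corank Sel = rank + t`), with `t₅(E_K) = 0` and `rank E_K + 1 ≤ ω + ω₁`.
[cite: Dokchitser2013ParityNotes, §4] [cite: SilvermanAEC2009, Thm. X.4.2 and Exercise 10.16] -/
theorem twist_door_of_le_rank :
    ((kubertTateFive (m : ℚ) (n : ℚ)).quadraticTwist (-4)).shaCorank 5 = 0 ∧
      (kubertTateFive (m : ℚ) (n : ℚ)).shaCorank 5 = 0 ∧
      ((kubertTateFive (m : ℚ) (n : ℚ)).quadraticTwist (-4)).mordellWeilRank =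
        ((m * n).natAbs.primeFactors.filter (fun ℓ ↦ ℓ % 4 = 1)).card := by
  haveI : Fact (Nat.Prime 5) := ⟨Nat.prime_five⟩
  haveI : IsCyclotomicExtension {4} ℚ (CyclotomicField 4 ℚ) := CyclotomicField.isCyclotomicExtension 4 ℚ
  haveI := isElliptic_base (K := CyclotomicField 4 ℚ) m n
  haveI hbc : ((kubertTateFive (m : ℚ) (n : ℚ)).baseChange (CyclotomicField 4 ℚ)).IsElliptic := by
    rw [KubertTateMuDescentNF.baseChange_eq (K := ℚ) m n (CyclotomicField 4 ℚ)]; infer_instance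
  have hd : ((NumberField.discr (CyclotomicField 4 ℚ) : ℤ) : ℚ) ≠ 0 := by
    exact_mod_cast NumberField.discr_ne_zero (CyclotomicField 4 ℚ)
  haveI : ((kubertTateFive (m : ℚ) (n : ℚ)).quadraticTwist (NumberField.discr (CyclotomicField 4 ℚ) : ℚ)).IsElliptic :=
    isElliptic_quadraticTwist _ hd
  have hS := selmerCorank_baseChange_quadratic_holds (kubertTateFive (m : ℚ) (n : ℚ)) (CyclotomicField 4 ℚ)
    finrank_rat_four' 5
  have hR := mordellWeilRank_baseChange_quadratic_holds (kubertTateFive (m : ℚ) (n : ℚ)) (CyclotomicField 4 ℚ)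
    finrank_rat_four'
  have hK := ((kubertTateFive (m : ℚ) (n : ℚ)).baseChange (CyclotomicField 4 ℚ)).selmerCorank_eq_mordellWeilRank_add_holds 5
  have hQ := (kubertTateFive (m : ℚ) (n : ℚ)).selmerCorank_eq_mordellWeilRank_add_holds 5
  have hT := ((kubertTateFive (m : ℚ) (n : ℚ)).quadraticTwist
    (NumberField.discr (CyclotomicField 4 ℚ) : ℚ)).selmerCorank_eq_mordellWeilRank_add_holds 5
  -- `t₅(E ⊗ ℚ(i)) = 0`: the box over `ℚ(i)` is full since `rank E(ℚ(i)) + 1 = rank E + rank E^{(-4)} + 1 ≥ ω + ω₁ ≥ #S`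
  have h0K : (kubertTateFive (m : CyclotomicField 4 ℚ) (n : CyclotomicField 4 ℚ)).shaCorank 5 = 0 := by
    obtain ⟨hm0, hn0, -⟩ := ne_zero_of_isElliptic (m : ℚ) (n : ℚ)
    have hm : m ≠ 0 := by exact_mod_cast hm0
    have hn : n ≠ 0 := by exact_mod_cast hn0
    obtain ⟨S, hScard, hS'⟩ := exists_support_split (K := CyclotomicField 4 ℚ) m n hm hn
    have hRK := mordellWeilRank_base_eq_add (K := CyclotomicField 4 ℚ) m n
    refine KubertTateMuDescentNF.shaCorank_five_eq_zero_of_le m n _ (fun σ ↦ smul_toGeomPoints _ σ _)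
      (twentyfive_zsmul_toGeomPoints_cast_ne_zero m n hxy hx0 hx q hq5 hq11 hqΔ) S hS' h5 hbad
      (box_full_of_card_le_rank_succ m n S ?_)
    omega
  have h0 : ((kubertTateFive (m : ℚ) (n : ℚ)).baseChange (CyclotomicField 4 ℚ)).shaCorank 5 = 0 := by
    rw [shaCorank_congr' (KubertTateMuDescentNF.baseChange_eq (K := ℚ) m n (CyclotomicField 4 ℚ)) 5]
    exact h0K
  have hbound := mordellWeilRank_twist_le_card_split m n h5 hbad hxy hx0 hx q hq5 hq11 hqΔ hr
  have h4 : ((NumberField.discr (CyclotomicField 4 ℚ) : ℤ) : ℚ) = -4 := by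
    rw [discr_cyclotomicField_four]; norm_num
  rw [h4] at hS hR hT
  omega

end Main

end KubertTateGaussianTwist

end Literature.NumberTheory.EllipticCurves

end
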